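import Summits.QuantumAdvantage.QuantumAdvantage.Theorems.SosSandwichPseudoBoundedAAClassicalCorner
import Literature.Computability.QuantumComplexity.DFKOInfluenceBoundProofs
import HarnessLib

/-!
# Crux `PseudoBoundedAA` (stmt-QuantumAdvantage-15237, route SosSandwich) — the NONADAPTIVE classical corner obeys the
# sharp law `16 · Var[p]² ≤ T · maxⱼ Infⱼ[p]`: adaptivity is the only possible source of a `T`-exponent gap on `R_T`

Support file for the rank-2 crux PB-AA (`Theses/SosSandwich.lean`, item stmt-QuantumAdvantage-15237).  On the classical
corner `R_T ⊆ K_T` (mixtures `p = Σ_k w_k·[t_k accepts]` of depth-`≤ T` decision trees) the tree holds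
`16·Var[p]² ≤ D̄²·maxⱼ Infⱼ[p]` (`ClassicalCorner.exists_influence_ge_of_mixture_depth_le`: exponent `2` in `T`), and whether
exponent ONE holds with the maximum outside the expectation is the open calibration question of the previous hands; the
companion file `…ClassicalCornerLevelOne` proves exponent one for the level-one part of the variance.

This file proves the full law with exponent ONE and the sharp constant `16` on the NONADAPTIVE sub-corner: acceptance
probabilities of classical algorithms whose queried set does not depend on the answers, i.e. mixtures
`p = Σ_k w_k · G_k` (`w_k ≥ 0`, `Σ w_k ≤ 1`) of `[0,1]`-valued functions `G_k` each depending on a set `S_k` of at most `T`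
coordinates (for decision trees: `t_k` reads only coordinates in `S_k`, `|S_k| ≤ T` — e.g. the complete tree on `S_k`; no
bound on the depth is needed):

  `16 · Var[p]² ≤ T · maxⱼ Infⱼ[p]`  (`sixteen_variance_sq_le_of_juntaMixture`, `…_of_nonadaptiveTrees`),

with equality shape at `T = 1` (query one uniformly random variable and output it: `Var = 1/(4N)`, `Inf = 1/N²`).  Hence a
family in `R_T` separating the `T`-exponents `1` and `2` must be genuinely ADAPTIVE (and, by the companion file, must carry
its variance at Fourier levels `≥ 2`).

Proof (Walsh basis, O'Donnell 2014 §1.4/§2.2): `Var[p] = Σ_{U≠∅} p̂(U)² = Σ_k w_k Σ_{U≠∅} p̂(U) Ĝ_k(U)`; a junta has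
`Ĝ_k(U) = 0` unless `U ⊆ S_k` (`cubeFourierCoeff_eq_zero_of_junta`), so by Cauchy–Schwarz the inner sum is at most
`√(Σ_{∅≠U⊆S_k} p̂(U)²) · √(Σ_{U≠∅} Ĝ_k(U)²) ≤ √(¼ Σ_{i∈S_k} Infᵢ[p]) · ½ ≤ ¼ √(T · maxInf)` (union bound over the at most
`T` elements of `S_k`, `Infᵢ = 4 Σ_{U∋i} p̂(U)²`, and `Var[G_k] ≤ ¼` for a `[0,1]`-valued function).

* `cubeFourierCoeff_mixture` — linearity of `p̂` in the mixture;
* `cubeFourierCoeff_eq_zero_of_junta` — `Ĝ(U) = 0` if `G` is an `S`-junta and `U ⊄ S`;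
* `sum_sq_cubeFourierCoeff_nonempty_le_quarter` — `Σ_{U≠∅} Ĝ(U)² ≤ ¼` for `0 ≤ G ≤ 1`;
* `sum_sq_cubeFourierCoeff_subset_le` — `Σ_{∅≠U⊆S} p̂(U)² ≤ ¼ Σ_{i∈S} Infᵢ[p]`;
* **`sixteen_variance_sq_le_of_juntaMixture`**, **`exists_influence_ge_of_juntaMixture`** (`∃ j, 16 Var² ≤ T·Infⱼ`),
  `exists_influence_ge_of_nonadaptiveTrees` (decision-tree form).

Honest label: an elementary Fourier-analytic inequality (Poincaré/Cauchy–Schwarz level) calibrating a sub-corner of the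
classical corner of an open conjecture; new to the tree as stated; no stub, crux or summit is closed.
Sources: R. O'Donnell, *Analysis of Boolean Functions* (CUP 2014) §1.4 (Parseval), §2.2 (influences in the Walsh basis),
§2.3 (Poincaré); S. Aaronson, A. Ambainis, *The need for structure in quantum speedups*, arXiv:0911.0996, Conj. 6 / Thm 8.
-/

set_option linter.dupNamespace false

noncomputable section

namespace Summit.QuantumAdvantage.QuantumAdvantage.Theorems.SosSandwich

open Finset Function
open Literature.Computability.Complexity Literature.Computability.QuantumComplexity
open Literature.Computability.Complexity.LowDegree (cubeFourierCoeff)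
open Literature.Probability.RandomGraphs.LowDegree (sgn sgn_true sgn_false walsh)

namespace ClassicalCornerNonadaptive

variable {N : ℕ}

/-! ### Walsh-basis bookkeeping -/

/-- Linearity of the cube Fourier coefficient in a finite mixture. [cite: ODonnell2014, §1.2] -/
theorem cubeFourierCoeff_mixture {ι : Type*} (s : Finset ι) (w : ι → ℝ) (G : ι → (Fin N → Bool) → ℝ)
    (P : (Fin N → Bool) → ℝ) (hP : ∀ x, P x = ∑ k ∈ s, w k * G k x) (U : Finset (Fin N)) :
    cubeFourierCoeff P U = ∑ k ∈ s, w k * cubeFourierCoeff (G k) U := by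
  unfold cubeFourierCoeff
  calc (∑ x, P x * walsh U x) / (2 : ℝ) ^ N
      = (∑ x, ∑ k ∈ s, w k * (G k x * walsh U x)) / (2 : ℝ) ^ N := by
        congr 1
        refine Finset.sum_congr rfl fun x _ => ?_
        rw [hP x, Finset.sum_mul]
        exact Finset.sum_congr rfl fun k _ => by ring
    _ = (∑ k ∈ s, w k * ∑ x, G k x * walsh U x) / (2 : ℝ) ^ N := by
        rw [Finset.sum_comm]
        congr 1
        exact Finset.sum_congr rfl fun k _ => by rw [Finset.mul_sum]
    _ = ∑ k ∈ s, w k * ((∑ x, G k x * walsh U x) / (2 : ℝ) ^ N) := by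
        rw [Finset.sum_div]
        exact Finset.sum_congr rfl fun k _ => by ring

/-- **A junta has no Fourier weight off its set**: if `G x` depends only on `x|_S` and `U ⊄ S` then `Ĝ(U) = 0` (pair `x` with
`x` flipped at a coordinate `j ∈ U ∖ S`: `G` is unchanged, `χ_U` changes sign). [cite: ODonnell2014, §2.2] -/
theorem cubeFourierCoeff_eq_zero_of_junta (G : (Fin N → Bool) → ℝ) (S : Finset (Fin N))
    (hG : ∀ x y : Fin N → Bool, (∀ i ∈ S, x i = y i) → G x = G y) (U : Finset (Fin N)) (hU : ¬ U ⊆ S) :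
    cubeFourierCoeff G U = 0 := by
  obtain ⟨j, hjU, hjS⟩ := Finset.not_subset.mp hU
  unfold cubeFourierCoeff
  rw [BooleanCorner.sum_eq_half_sum_update j (fun x => G x * walsh U x)]
  have hGj : ∀ (x : Fin N → Bool) (b : Bool), G (update x j b) = G x := fun x b =>
    hG _ _ fun i hi => by rw [update_of_ne (ne_of_mem_of_not_mem hi hjS)]
  have hW : ∀ (x : Fin N → Bool) (b : Bool), walsh U (update x j b) = sgn b * ∏ i ∈ U.erase j, sgn (x i) := by
    intro x b
    unfold walsh
    rw [← Finset.mul_prod_erase U (fun i => sgn (update x j b i)) hjU]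
    simp only [update_self]
    congr 1
    exact Finset.prod_congr rfl fun i hi => by rw [update_of_ne (Finset.ne_of_mem_erase hi)]
  simp only [hGj, hW, sgn_true, sgn_false]
  rw [← Finset.sum_add_distrib]
  rw [Finset.sum_eq_zero fun x _ => by ring]
  simp

/-- `Σ_{U : 1 ≤ |U|} Ĝ(U)² ≤ ¼` for a `[0,1]`-valued `G`: Parseval gives `E[G²] − (E G)² ≤ E G − (E G)² ≤ ¼`.
[cite: ODonnell2014, §1.4 (Parseval)] -/
theorem sum_sq_cubeFourierCoeff_nonempty_le_quarter (G : (Fin N → Bool) → ℝ) (hG : ∀ x, 0 ≤ G x ∧ G x ≤ 1) :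
    ∑ U ∈ Finset.univ.filter (fun U : Finset (Fin N) => 1 ≤ U.card), cubeFourierCoeff G U ^ 2 ≤ 1 / 4 := by
  classical
  have h2N : (0 : ℝ) < (2 : ℝ) ^ N := by positivity
  have hsplit := Finset.sum_filter_add_sum_filter_not (Finset.univ : Finset (Finset (Fin N)))
    (fun U : Finset (Fin N) => 1 ≤ U.card) (fun U => cubeFourierCoeff G U ^ 2)
  have hnot : Finset.univ.filter (fun U : Finset (Fin N) => ¬ 1 ≤ U.card) = {∅} := by
    ext U
    simp only [Finset.mem_filter, Finset.mem_univ, true_and, Finset.mem_singleton, not_le, Nat.lt_one_iff,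
      Finset.card_eq_zero]
  rw [hnot, Finset.sum_singleton, LowDegree.sum_cubeFourierCoeff_sq, LowDegree.cubeFourierCoeff_empty] at hsplit
  -- `m := E G ∈ [0,1]`, `E[G²] ≤ m`
  have hsq_le : (∑ x, G x ^ 2) / (2 : ℝ) ^ N ≤ (∑ x, G x) / (2 : ℝ) ^ N :=
    div_le_div_of_nonneg_right (Finset.sum_le_sum fun x _ => by nlinarith [hG x]) h2N.le
  have hm0 : 0 ≤ (∑ x, G x) / (2 : ℝ) ^ N := div_nonneg (Finset.sum_nonneg fun x _ => (hG x).1) h2N.le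
  have hm1 : (∑ x, G x) / (2 : ℝ) ^ N ≤ 1 := by
    rw [div_le_one h2N]
    calc ∑ x, G x ≤ ∑ _x : Fin N → Bool, (1 : ℝ) := Finset.sum_le_sum fun x _ => (hG x).2
      _ = (2 : ℝ) ^ N := by
          rw [Finset.sum_const, Finset.card_univ, BooleanCorner.card_cube_nat, nsmul_eq_mul]
          push_cast
          ring
  nlinarith [sq_nonneg ((∑ x, G x) / (2 : ℝ) ^ N - 1 / 2)]

/-- **Union bound over a set of coordinates**: `Σ_{1 ≤ |U|, U ⊆ S} p̂(U)² ≤ ¼ Σ_{i∈S} Infᵢ[p]` (`Infᵢ = 4 Σ_{U∋i} p̂(U)²`, and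
every nonempty `U ⊆ S` contains some `i ∈ S`). [cite: ODonnell2014, §2.2 (Fourier formula for influences)] -/
theorem sum_sq_cubeFourierCoeff_subset_le (p : MvPolynomial (Fin N) ℝ) (S : Finset (Fin N)) :
    ∑ U ∈ (Finset.univ.filter (fun U : Finset (Fin N) => 1 ≤ U.card)).filter (fun U => U ⊆ S),
        cubeFourierCoeff (evalBool p) U ^ 2 ≤ (∑ i ∈ S, influence i p) / 4 := by
  classical
  set c : Finset (Fin N) → ℝ := fun U => cubeFourierCoeff (evalBool p) U ^ 2 with hc
  have hc0 : ∀ U, 0 ≤ c U := fun U => sq_nonneg _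
  -- right-hand side in the Walsh basis: `Σ_{i∈S} Σ_{U∋i} c U = Σ_U c U · |S ∩ U|`
  have hinf : (∑ i ∈ S, influence i p) / 4 = ∑ i ∈ S, ∑ U ∈ Finset.univ.filter (fun U : Finset (Fin N) => i ∈ U), c U := by
    rw [Finset.sum_div]
    refine Finset.sum_congr rfl fun i _ => ?_
    rw [influence_eq_sum_sq_fourier]
    ring
  rw [hinf]
  have hswap : ∑ i ∈ S, ∑ U ∈ Finset.univ.filter (fun U : Finset (Fin N) => i ∈ U), c U
      = ∑ U, c U * ((S.filter (fun i => i ∈ U)).card : ℝ) := by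
    simp_rw [Finset.sum_filter]
    rw [Finset.sum_comm]
    refine Finset.sum_congr rfl fun U _ => ?_
    rw [Finset.card_eq_sum_ones, Nat.cast_sum, Finset.mul_sum, Finset.sum_filter]
    refine Finset.sum_congr rfl fun i _ => ?_
    split_ifs <;> simp
  rw [hswap, Finset.sum_filter, Finset.sum_filter]
  refine Finset.sum_le_sum fun U _ => ?_
  by_cases h1 : 1 ≤ U.card
  · rw [if_pos h1]
    by_cases h2 : U ⊆ S
    · rw [if_pos h2]
      have hSU : S.filter (fun i => i ∈ U) = U := by
        rw [Finset.filter_mem_eq_inter, Finset.inter_eq_right.mpr h2]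
      rw [hSU]
      have h1' : (1 : ℝ) ≤ (U.card : ℝ) := by exact_mod_cast h1
      exact le_mul_of_one_le_right (hc0 U) h1'
    · rw [if_neg h2]
      exact mul_nonneg (hc0 U) (Nat.cast_nonneg _)
  · rw [if_neg h1]
    exact mul_nonneg (hc0 U) (Nat.cast_nonneg _)

/-! ### The nonadaptive law -/

/-- **`4 · Var[p] ≤ √(T · M)` for mixtures of `[0,1]`-valued `≤ T`-juntas (nonadaptive classical algorithms).**  If on the
cube `p = Σ_{k∈s} w_k G_k` with `w_k ≥ 0`, `Σ w_k ≤ 1`, `0 ≤ G_k ≤ 1`, and `G_k x` depends only on `x|_{S_k}` with `|S_k| ≤ T`,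
then `4 · Var[p] ≤ √(T · M)` for every `M` dominating all influences of `p`.  Walsh-basis proof:
`Var = Σ_k w_k Σ_{∅≠U⊆S_k} p̂(U) Ĝ_k(U) ≤ Σ_k w_k · √(¼ Σ_{i∈S_k} Infᵢ) · ½ ≤ ¼ √(T·M)`.
[cite: ODonnell2014, §1.4, §2.2] [cite: AaronsonAmbainis2014, Conj. 6 / Thm 8] -/
theorem four_variance_le_sqrt_of_juntaMixture {ι : Type*} (s : Finset ι) (w : ι → ℝ) (hw : ∀ k ∈ s, 0 ≤ w k)
    (hw1 : ∑ k ∈ s, w k ≤ 1) (S : ι → Finset (Fin N)) (T : ℕ) (hS : ∀ k ∈ s, (S k).card ≤ T)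
    (G : ι → (Fin N → Bool) → ℝ) (hG01 : ∀ k ∈ s, ∀ x, 0 ≤ G k x ∧ G k x ≤ 1)
    (hGdep : ∀ k ∈ s, ∀ x y : Fin N → Bool, (∀ i ∈ S k, x i = y i) → G k x = G k y)
    (p : MvPolynomial (Fin N) ℝ) (hp : ∀ x, evalBool p x = ∑ k ∈ s, w k * G k x)
    (M : ℝ) (hM : ∀ i, influence i p ≤ M) :
    4 * boolVariance p ≤ Real.sqrt ((T : ℝ) * M) := by
  classical
  rcases Nat.eq_zero_or_pos N with hN0 | hNpos
  · subst hN0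
    rw [BooleanCorner.boolVariance_fin_zero p, mul_zero]
    exact Real.sqrt_nonneg _
  have hM0 : 0 ≤ M := (influence_nonneg ⟨0, hNpos⟩ p).trans (hM _)
  have hTM4 : 0 ≤ (T : ℝ) * M / 4 := div_nonneg (mul_nonneg (Nat.cast_nonneg T) hM0) (by norm_num)
  -- (1) the variance in the Walsh basis
  have hvar : boolVariance p = ∑ U ∈ Finset.univ.filter (fun U : Finset (Fin N) => 1 ≤ U.card),
      cubeFourierCoeff (evalBool p) U ^ 2 := by
    rw [boolVariance_eq_tailWeight_one]
    rfl
  -- (2) expand one factor by linearity in the mixture and swap the sums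
  have hlin : ∀ U, cubeFourierCoeff (evalBool p) U = ∑ k ∈ s, w k * cubeFourierCoeff (G k) U :=
    cubeFourierCoeff_mixture s w G (evalBool p) hp
  have hexp : ∑ U ∈ Finset.univ.filter (fun U : Finset (Fin N) => 1 ≤ U.card), cubeFourierCoeff (evalBool p) U ^ 2
      = ∑ k ∈ s, w k * ∑ U ∈ Finset.univ.filter (fun U : Finset (Fin N) => 1 ≤ U.card),
          cubeFourierCoeff (evalBool p) U * cubeFourierCoeff (G k) U := by
    calc ∑ U ∈ Finset.univ.filter (fun U : Finset (Fin N) => 1 ≤ U.card), cubeFourierCoeff (evalBool p) U ^ 2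
        = ∑ U ∈ Finset.univ.filter (fun U : Finset (Fin N) => 1 ≤ U.card),
            ∑ k ∈ s, w k * (cubeFourierCoeff (evalBool p) U * cubeFourierCoeff (G k) U) := by
          refine Finset.sum_congr rfl fun U _ => ?_
          calc cubeFourierCoeff (evalBool p) U ^ 2
              = cubeFourierCoeff (evalBool p) U * ∑ k ∈ s, w k * cubeFourierCoeff (G k) U := by
                rw [← hlin U, sq]
            _ = ∑ k ∈ s, w k * (cubeFourierCoeff (evalBool p) U * cubeFourierCoeff (G k) U) := by
                rw [Finset.mul_sum]
                exact Finset.sum_congr rfl fun k _ => by ring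
      _ = ∑ k ∈ s, ∑ U ∈ Finset.univ.filter (fun U : Finset (Fin N) => 1 ≤ U.card),
            w k * (cubeFourierCoeff (evalBool p) U * cubeFourierCoeff (G k) U) := Finset.sum_comm
      _ = _ := Finset.sum_congr rfl fun k _ => by rw [Finset.mul_sum]
  -- (3) per component: restrict to `U ⊆ S k`, Cauchy–Schwarz, bound the two factors
  have hk : ∀ k ∈ s, ∑ U ∈ Finset.univ.filter (fun U : Finset (Fin N) => 1 ≤ U.card),
      cubeFourierCoeff (evalBool p) U * cubeFourierCoeff (G k) U ≤ Real.sqrt ((T : ℝ) * M / 4) * (1 / 2) := by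
    intro k hk
    have hrestr : ∑ U ∈ (Finset.univ.filter (fun U : Finset (Fin N) => 1 ≤ U.card)).filter (fun U => U ⊆ S k),
          cubeFourierCoeff (evalBool p) U * cubeFourierCoeff (G k) U
        = ∑ U ∈ Finset.univ.filter (fun U : Finset (Fin N) => 1 ≤ U.card),
          cubeFourierCoeff (evalBool p) U * cubeFourierCoeff (G k) U := by
      rw [Finset.sum_filter]
      refine Finset.sum_congr rfl fun U _ => ?_
      split_ifs with h
      · rfl
      · rw [cubeFourierCoeff_eq_zero_of_junta (G k) (S k) (hGdep k hk) U h, mul_zero]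
    rw [← hrestr]
    have hcs := Finset.sum_mul_sq_le_sq_mul_sq
      ((Finset.univ.filter (fun U : Finset (Fin N) => 1 ≤ U.card)).filter (fun U => U ⊆ S k))
      (fun U => cubeFourierCoeff (evalBool p) U) (fun U => cubeFourierCoeff (G k) U)
    have h1 : ∑ U ∈ (Finset.univ.filter (fun U : Finset (Fin N) => 1 ≤ U.card)).filter (fun U => U ⊆ S k),
        cubeFourierCoeff (evalBool p) U ^ 2 ≤ (T : ℝ) * M / 4 := by
      calc _ ≤ (∑ i ∈ S k, influence i p) / 4 := sum_sq_cubeFourierCoeff_subset_le p (S k)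
        _ ≤ ((S k).card : ℝ) * M / 4 := by
            refine div_le_div_of_nonneg_right ?_ (by norm_num)
            calc ∑ i ∈ S k, influence i p ≤ ∑ _i ∈ S k, M := Finset.sum_le_sum fun i _ => hM i
              _ = ((S k).card : ℝ) * M := by rw [Finset.sum_const, nsmul_eq_mul]
        _ ≤ (T : ℝ) * M / 4 := by
            refine div_le_div_of_nonneg_right (mul_le_mul_of_nonneg_right ?_ hM0) (by norm_num)
            exact_mod_cast hS k hk
    have h2 : ∑ U ∈ (Finset.univ.filter (fun U : Finset (Fin N) => 1 ≤ U.card)).filter (fun U => U ⊆ S k),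
        cubeFourierCoeff (G k) U ^ 2 ≤ 1 / 4 :=
      (Finset.sum_le_sum_of_subset_of_nonneg (Finset.filter_subset _ _) (fun U _ _ => sq_nonneg _)).trans
        (sum_sq_cubeFourierCoeff_nonempty_le_quarter (G k) (hG01 k hk))
    have h1nn : 0 ≤ ∑ U ∈ (Finset.univ.filter (fun U : Finset (Fin N) => 1 ≤ U.card)).filter (fun U => U ⊆ S k),
        cubeFourierCoeff (G k) U ^ 2 := Finset.sum_nonneg fun U _ => sq_nonneg _
    have hquarter : Real.sqrt (1 / 4 : ℝ) = 1 / 2 := by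
      rw [show (1 / 4 : ℝ) = (1 / 2) ^ 2 by norm_num, Real.sqrt_sq (by norm_num)]
    calc ∑ U ∈ (Finset.univ.filter (fun U : Finset (Fin N) => 1 ≤ U.card)).filter (fun U => U ⊆ S k),
          cubeFourierCoeff (evalBool p) U * cubeFourierCoeff (G k) U
        ≤ Real.sqrt ((∑ U ∈ (Finset.univ.filter (fun U : Finset (Fin N) => 1 ≤ U.card)).filter (fun U => U ⊆ S k),
              cubeFourierCoeff (evalBool p) U ^ 2) *
            ∑ U ∈ (Finset.univ.filter (fun U : Finset (Fin N) => 1 ≤ U.card)).filter (fun U => U ⊆ S k),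
              cubeFourierCoeff (G k) U ^ 2) := Real.le_sqrt_of_sq_le hcs
      _ ≤ Real.sqrt ((T : ℝ) * M / 4 * (1 / 4)) := Real.sqrt_le_sqrt (mul_le_mul h1 h2 h1nn hTM4)
      _ = Real.sqrt ((T : ℝ) * M / 4) * (1 / 2) := by
          rw [Real.sqrt_mul hTM4, hquarter]
  -- (4) assemble: `Var ≤ (Σ w) · ½ √(TM/4) ≤ ½ √(TM/4) = ¼ √(TM)`
  have hR0 : 0 ≤ Real.sqrt ((T : ℝ) * M / 4) * (1 / 2) := by positivity
  have hsum : boolVariance p ≤ (∑ k ∈ s, w k) * (Real.sqrt ((T : ℝ) * M / 4) * (1 / 2)) := by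
    rw [hvar, hexp, Finset.sum_mul]
    exact Finset.sum_le_sum fun k hk' => mul_le_mul_of_nonneg_left (hk k hk') (hw k hk')
  have hvar_le : boolVariance p ≤ Real.sqrt ((T : ℝ) * M / 4) * (1 / 2) :=
    hsum.trans ((mul_le_mul_of_nonneg_right hw1 hR0).trans_eq (one_mul _))
  have hfour : Real.sqrt (4 : ℝ) = 2 := by
    rw [show (4 : ℝ) = 2 ^ 2 by norm_num, Real.sqrt_sq zero_le_two]
  rw [Real.sqrt_div' _ zero_le_four, hfour] at hvar_le
  linarith

/-- **`16 · Var[p]² ≤ T · maxⱼ Infⱼ[p]` on the nonadaptive classical corner** (mixtures of `[0,1]`-valued `≤ T`-juntas): if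
`Var[p] > 0` then for the variable `j` of largest influence `16 · Var[p]² ≤ T · Infⱼ[p]` — exponent `2` in the variance
(sharp at `T = 1`) and exponent ONE in `T`; compare `16·Var² ≤ D̄²·maxInf` for general (adaptive) mixtures
(`ClassicalCorner.exists_influence_ge_of_mixture_depth_le`). [cite: ODonnell2014, §1.4, §2.2]
[cite: AaronsonAmbainis2014, Conj. 6 / Thm 8] -/
theorem exists_influence_ge_of_juntaMixture {ι : Type*} (s : Finset ι) (w : ι → ℝ) (hw : ∀ k ∈ s, 0 ≤ w k)
    (hw1 : ∑ k ∈ s, w k ≤ 1) (S : ι → Finset (Fin N)) (T : ℕ) (hS : ∀ k ∈ s, (S k).card ≤ T)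
    (G : ι → (Fin N → Bool) → ℝ) (hG01 : ∀ k ∈ s, ∀ x, 0 ≤ G k x ∧ G k x ≤ 1)
    (hGdep : ∀ k ∈ s, ∀ x y : Fin N → Bool, (∀ i ∈ S k, x i = y i) → G k x = G k y)
    (p : MvPolynomial (Fin N) ℝ) (hp : ∀ x, evalBool p x = ∑ k ∈ s, w k * G k x)
    (hv : 0 < boolVariance p) :
    ∃ j : Fin N, 16 * boolVariance p ^ 2 ≤ (T : ℝ) * influence j p := by
  classical
  rcases Nat.eq_zero_or_pos N with hN0 | hNpos
  · subst hN0
    exact absurd (BooleanCorner.boolVariance_fin_zero p) (ne_of_gt hv)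
  have hne : (Finset.univ : Finset (Fin N)).Nonempty := ⟨⟨0, hNpos⟩, Finset.mem_univ _⟩
  obtain ⟨j, -, hj⟩ := Finset.exists_max_image Finset.univ (fun j => influence j p) hne
  refine ⟨j, ?_⟩
  have h4 := four_variance_le_sqrt_of_juntaMixture s w hw hw1 S T hS G hG01 hGdep p hp (influence j p)
    (fun i => hj i (Finset.mem_univ _))
  have hTM : 0 ≤ (T : ℝ) * influence j p := mul_nonneg (Nat.cast_nonneg _) (influence_nonneg j p)
  have hv0 := boolVariance_nonneg p
  calc 16 * boolVariance p ^ 2 = (4 * boolVariance p) ^ 2 := by ring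
    _ ≤ Real.sqrt ((T : ℝ) * influence j p) ^ 2 := pow_le_pow_left₀ (by linarith) h4 2
    _ = (T : ℝ) * influence j p := Real.sq_sqrt hTM

/-- **Decision-tree form (nonadaptive randomized classical query algorithms).**  If `p = Σ_k w_k·[t_k accepts]` on the cube
(`w_k ≥ 0`, `Σ w_k ≤ 1`) where the tree `t_k` reads only coordinates in a set `S_k` with `|S_k| ≤ T` (its output is determined by
`x|_{S_k}`; no bound on the depth is needed), and `Var[p] > 0`, then `16 · Var[p]² ≤ T · Infⱼ[p]` for some `j`.  On this
sub-corner of `R_T` the law holds with exponent ONE in `T`; so a family in `R_T` separating the exponents `1` and `2` must be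
adaptive. [cite: ODonnell2014, §1.4, §2.2] [cite: AaronsonAmbainis2014, Conj. 6 / Thm 8] -/
theorem exists_influence_ge_of_nonadaptiveTrees {ι : Type*} (s : Finset ι) (w : ι → ℝ) (hw : ∀ k ∈ s, 0 ≤ w k)
    (hw1 : ∑ k ∈ s, w k ≤ 1) (S : ι → Finset (Fin N)) (T : ℕ) (hS : ∀ k ∈ s, (S k).card ≤ T)
    (t : ι → DecisionTree N)
    (ht : ∀ k ∈ s, ∀ x y : Fin N → Bool, (∀ i ∈ S k, x i = y i) → (t k).eval x = (t k).eval y)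
    (p : MvPolynomial (Fin N) ℝ)
    (hp : ∀ x, evalBool p x = ∑ k ∈ s, w k * (if (t k).eval x = true then (1 : ℝ) else 0))
    (hv : 0 < boolVariance p) :
    ∃ j : Fin N, 16 * boolVariance p ^ 2 ≤ (T : ℝ) * influence j p :=
  exists_influence_ge_of_juntaMixture s w hw hw1 S T hS (fun k x => if (t k).eval x = true then (1 : ℝ) else 0)
    (fun k _ x => by
      show 0 ≤ (if (t k).eval x = true then (1 : ℝ) else 0) ∧ (if (t k).eval x = true then (1 : ℝ) else 0) ≤ 1
      split_ifs <;> norm_num)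
    (fun k hk x y hxy => by
      show (if (t k).eval x = true then (1 : ℝ) else 0) = (if (t k).eval y = true then (1 : ℝ) else 0)
      rw [ht k hk x y hxy])
    p hp hv

end ClassicalCornerNonadaptive

end Summit.QuantumAdvantage.QuantumAdvantage.Theorems.SosSandwich

end
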